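import Mathlib
import HarnessLib
import Summits.CriticalPhenomena.PercolationContinuityZ3.Theorems.PercNearOneGluingNoHeavyLowerTailAPLVwPerVertex

/-!
# `NoHeavyLowerTail` (stmt-CriticalPhenomena-4575) — (V_w) vertex by vertex: the seed-LAYER mixture identity and the canonical
# (selection-free) induction step for the per-vertex inequality (PV)

Support file (prover prim-ineq-gen-8 gen 43; `--supports stmt-CriticalPhenomena-4575`; memo
run/shared/lean/prim/prim-ineq-gen-8/FINDING-gen43-LAYER.md).  No definitions, no named facts, no sorries; pure real algebra over
a finite index set of "corners".

Context.  Gen 42 (file `…APLVwPerVertex`) reduced (V_w) to the per-vertex inequality (PV) `T_v := N_v²/p_v + 2G_v ≤ 0` and proved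
its induction step along ONE apex edge under the selection criterion (SEL).  Gen 43 replaces the one-edge step by a whole-LAYER
step that needs no selection: reveal all seed coins of the current apex layer at once.  The actual instance is then the mixture,
with product weights `π_c`, of the CORNER instances `c` (seed subset glued / the other seeds cut); the five linear statistics
`p = P(I_v)`, `m = E[I_v A]`, `a = E A`, `ζ = E Z_v`, `e = E[A Z_v]` are `π`-averages of the corner statistics, while the covariances
`N = m − p a`, `G = e − a ζ` pick up the between-corner terms.  For every test value `λ` the linearised functional
`Ψ_λ = 2λN − λ²p + 2G` satisfies EXACTLY (`pv_layer_mixture`)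
`Ψ_λ(mixture) = Σ_c π_c Ψ_λ(c) + 2·[Σ_c π_c a_c (λ p_c + ζ_c) − (Σ π a)(λ Σ π p + Σ π ζ)]`
(the bracket is the covariance, under `π`, of the corner mean load `a_c` with the corner mean of `λ I_v + Z_v`).  Consequently
(`pv_layer_step`, `pv_layer_Tv_step`): if every corner satisfies (PV) (in the division-free form `∀ t, Ψ_t(c) ≤ 0`) and the
LAYER INEQUALITY `2·Cov_π(a_c, λ p_c + ζ_c) ≤ Σ_c π_c [(2 t_c N_c − t_c² p_c) − (2 λ N_c − λ² p_c)]` holds for the actual boost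
`λ = N/p` and some corner test values `t_c` (optimally the corner boosts `t_c = N_c/p_c`, for which the right side is
`Σ_c π_c p_c (λ − N_c/p_c)²`, `pv_gain_eq`), then `T_v(mixture) ≤ 0`.  Iterating over breadth-first layers this proves (PV) from the
layer inequality alone ((SUBMEAN) of the memo: `T_v ≤ E_π T_v(corner)`; numerically 0 failures, and implied by the sharper
constant-4 form (Q) `4·Cov_π(a_c, λp_c + ζ_c) ≤ Σ_c π_c p_c(λ − Δ_c)²  ∀λ`, `pv_layer_step_of_four`).  `pv_submean_slack` records the
exact slack `Σ_c π_c T_c − T_v(mixture) = Σ_c π_c p_c(λ − Δ_c)² − 2Cov_π(a_c, λp_c + ζ_c)`.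
[this work]
-/

noncomputable section

namespace Summit.CriticalPhenomena.PercolationContinuityZ3.Theorems

namespace APL

open Finset
open scoped BigOperators

variable {ι : Type*} [Fintype ι]

/-! ### The layer mixture identity -/

/-- **Layer mixture identity for the linearised per-vertex functional.**  For corner statistics `p, m, a, ζ, e : ι → ℝ`, arbitrary
weights `π` and a test value `λ`, with the mixture statistics `P = Σπp`, `M = Σπm`, `A = Σπa`, `Zb = Σπζ`, `E = Σπe`:
`Ψ_λ(mix) := 2λ(M − P A) − λ²P + 2(E − A Zb) = Σ_c π_c Ψ_λ(c) + 2[Σ_c π_c a_c(λp_c + ζ_c) − A(λP + Zb)]`,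
`Ψ_λ(c) = 2λ(m_c − p_c a_c) − λ²p_c + 2(e_c − a_c ζ_c)`.  (No normalisation of `π` is needed.) [this work] -/
theorem pv_layer_mixture (π p m a ζ e : ι → ℝ) (lam : ℝ) :
    2 * lam * (∑ c, π c * m c - (∑ c, π c * p c) * (∑ c, π c * a c)) - lam ^ 2 * (∑ c, π c * p c)
        + 2 * (∑ c, π c * e c - (∑ c, π c * a c) * (∑ c, π c * ζ c)) =
      ∑ c, π c * (2 * lam * (m c - p c * a c) - lam ^ 2 * p c + 2 * (e c - a c * ζ c))
        + 2 * (∑ c, π c * (a c * (lam * p c + ζ c))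
              - (∑ c, π c * a c) * (lam * (∑ c, π c * p c) + ∑ c, π c * ζ c)) := by
  have h1 : ∑ c, π c * (2 * lam * (m c - p c * a c) - lam ^ 2 * p c + 2 * (e c - a c * ζ c))
      + 2 * ∑ c, π c * (a c * (lam * p c + ζ c)) = ∑ c, π c * (2 * lam * m c - lam ^ 2 * p c + 2 * e c) := by
    rw [Finset.mul_sum, ← Finset.sum_add_distrib]
    exact Finset.sum_congr rfl (fun c _ => by ring)
  have h2 : ∑ c, π c * (2 * lam * m c - lam ^ 2 * p c + 2 * e c)
      = 2 * lam * ∑ c, π c * m c - lam ^ 2 * ∑ c, π c * p c + 2 * ∑ c, π c * e c := by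
    rw [Finset.mul_sum, Finset.mul_sum, Finset.mul_sum, ← Finset.sum_sub_distrib, ← Finset.sum_add_distrib]
    exact Finset.sum_congr rfl (fun c _ => by ring)
  linear_combination -(h1 + h2)

/-- **Re-optimising a corner.**  For `p > 0` the linearisation at `λ` is the corner functional minus the square of the boost
mismatch: `2λN − λ²p + 2G = (N²/p + 2G) − p(λ − N/p)²`. [folklore] -/
theorem pv_corner_reopt (lam N G p : ℝ) (hp : 0 < p) :
    2 * lam * N - lam ^ 2 * p + 2 * G = (N ^ 2 / p + 2 * G) - p * (lam - N / p) ^ 2 := by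
  field_simp
  ring

/-- The gain from re-optimising a corner from `λ` to its own boost `N/p` is `p(λ − N/p)²` (`p > 0`). [folklore] -/
theorem pv_gain_eq (lam N p : ℝ) (hp : 0 < p) :
    (2 * (N / p) * N - (N / p) ^ 2 * p) - (2 * lam * N - lam ^ 2 * p) = p * (lam - N / p) ^ 2 := by
  field_simp
  ring

/-- The re-optimisation gain is non-negative for the optimal corner test value (`p > 0`). [folklore] -/
theorem pv_gain_nonneg (lam N p : ℝ) (hp : 0 < p) :
    0 ≤ (2 * (N / p) * N - (N / p) ^ 2 * p) - (2 * lam * N - lam ^ 2 * p) := by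
  rw [pv_gain_eq lam N p hp]
  positivity

/-! ### The canonical layer step -/

/-- **Layer step for the linearised functional (division-free).**  Weights `π ≥ 0`; every corner satisfies the per-vertex
inequality in the form `Ψ_{t_c}(c) ≤ 0` for the chosen corner test values `t_c`; and the LAYER INEQUALITY holds at `λ`:
`2[Σπ a(λp+ζ) − A(λP+Zb)] ≤ Σ_c π_c[(2t_cN_c − t_c²p_c) − (2λN_c − λ²p_c)]`, `N_c = m_c − p_c a_c`.  Then `Ψ_λ(mixture) ≤ 0`.
[this work] -/
theorem pv_layer_step (π p m a ζ e t : ι → ℝ) (lam : ℝ) (hπ : ∀ c, 0 ≤ π c)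
    (hcorner : ∀ c, 2 * t c * (m c - p c * a c) - t c ^ 2 * p c + 2 * (e c - a c * ζ c) ≤ 0)
    (hlayer : 2 * (∑ c, π c * (a c * (lam * p c + ζ c))
              - (∑ c, π c * a c) * (lam * (∑ c, π c * p c) + ∑ c, π c * ζ c))
        ≤ ∑ c, π c * ((2 * t c * (m c - p c * a c) - t c ^ 2 * p c)
              - (2 * lam * (m c - p c * a c) - lam ^ 2 * p c))) :
    2 * lam * (∑ c, π c * m c - (∑ c, π c * p c) * (∑ c, π c * a c)) - lam ^ 2 * (∑ c, π c * p c)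
        + 2 * (∑ c, π c * e c - (∑ c, π c * a c) * (∑ c, π c * ζ c)) ≤ 0 := by
  rw [pv_layer_mixture]
  have hsum : ∑ c, π c * (2 * lam * (m c - p c * a c) - lam ^ 2 * p c + 2 * (e c - a c * ζ c))
      + ∑ c, π c * ((2 * t c * (m c - p c * a c) - t c ^ 2 * p c) - (2 * lam * (m c - p c * a c) - lam ^ 2 * p c))
      = ∑ c, π c * (2 * t c * (m c - p c * a c) - t c ^ 2 * p c + 2 * (e c - a c * ζ c)) := by
    rw [← Finset.sum_add_distrib]
    exact Finset.sum_congr rfl (fun c _ => by ring)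
  have hneg : ∑ c, π c * (2 * t c * (m c - p c * a c) - t c ^ 2 * p c + 2 * (e c - a c * ζ c)) ≤ 0 :=
    Finset.sum_nonpos (fun c _ => mul_nonpos_of_nonneg_of_nonpos (hπ c) (hcorner c))
  linarith

/-- **Layer step for `T_v`.**  If in addition the mixture hit probability `P = Σπp` is positive, then taking `λ` to be the actual boost
`(M − PA)/P` gives `T_v(mixture) = (M − PA)²/P + 2(E − A·Zb) ≤ 0`.  (Percolation reading: reveal the whole seed layer; if every corner
instance satisfies (PV) and the layer inequality holds at the boost, the actual instance satisfies (PV).) [this work] -/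
theorem pv_layer_Tv_step (π p m a ζ e t : ι → ℝ) (hπ : ∀ c, 0 ≤ π c) (hP : 0 < ∑ c, π c * p c)
    (hcorner : ∀ c, 2 * t c * (m c - p c * a c) - t c ^ 2 * p c + 2 * (e c - a c * ζ c) ≤ 0)
    (hlayer :
      let lam := (∑ c, π c * m c - (∑ c, π c * p c) * (∑ c, π c * a c)) / (∑ c, π c * p c)
      2 * (∑ c, π c * (a c * (lam * p c + ζ c))
              - (∑ c, π c * a c) * (lam * (∑ c, π c * p c) + ∑ c, π c * ζ c))
        ≤ ∑ c, π c * ((2 * t c * (m c - p c * a c) - t c ^ 2 * p c)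
              - (2 * lam * (m c - p c * a c) - lam ^ 2 * p c))) :
    (∑ c, π c * m c - (∑ c, π c * p c) * (∑ c, π c * a c)) ^ 2 / (∑ c, π c * p c)
        + 2 * (∑ c, π c * e c - (∑ c, π c * a c) * (∑ c, π c * ζ c)) ≤ 0 := by
  set P := ∑ c, π c * p c with hPdef
  set N := ∑ c, π c * m c - P * (∑ c, π c * a c) with hNdef
  set G := ∑ c, π c * e c - (∑ c, π c * a c) * (∑ c, π c * ζ c) with hGdef
  have hstep := pv_layer_step π p m a ζ e t (N / P) hπ hcorner hlayer
  have heq := pv_lin_eq N G P hP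
  rw [← hNdef, ← hGdef] at hstep
  linarith

/-- **The constant-4 layer inequality suffices.**  If the right side (the re-optimisation gain) is non-negative — it is, for the
optimal corner test values, by `pv_gain_nonneg` — then the sharper form `4·Cov ≤ gain` ((Q) of the memo) implies the form
`2·Cov ≤ gain` used in `pv_layer_step`. [this work] -/
theorem pv_layer_step_of_four (cov gain : ℝ) (hgain : 0 ≤ gain) (h4 : 4 * cov ≤ gain) : 2 * cov ≤ gain := by
  by_cases h : 0 ≤ cov <;> linarith

/-! ### The exact slack of the sub-mean property -/

/-- **Sub-mean slack identity.**  With all corner hit probabilities positive, `T_c = N_c²/p_c + 2G_c`, the mixture boost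
`λ = N/P` and `P > 0`:
`Σ_c π_c T_c − T_v(mixture) = Σ_c π_c p_c(λ − N_c/p_c)² − 2[Σπ a(λp+ζ) − A(λP+Zb)]`.
So `T_v(mixture) ≤ Σ_c π_c T_c` ((SUBMEAN) of the memo, which with `Σπ_c = 1` and (PV) at the corners gives (PV)) is EXACTLY the
layer inequality at the boost with the optimal corner test values. [this work] -/
theorem pv_submean_slack (π p m a ζ e : ι → ℝ) (hp : ∀ c, 0 < p c) (hP : 0 < ∑ c, π c * p c) :
    let P := ∑ c, π c * p c
    let N := ∑ c, π c * m c - P * (∑ c, π c * a c)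
    let lam := N / P
    ∑ c, π c * ((m c - p c * a c) ^ 2 / p c + 2 * (e c - a c * ζ c))
        - (N ^ 2 / P + 2 * (∑ c, π c * e c - (∑ c, π c * a c) * (∑ c, π c * ζ c)))
      = ∑ c, π c * (p c * (lam - (m c - p c * a c) / p c) ^ 2)
        - 2 * (∑ c, π c * (a c * (lam * p c + ζ c))
              - (∑ c, π c * a c) * (lam * P + ∑ c, π c * ζ c)) := by
  intro P N lam
  have hmix := pv_layer_mixture π p m a ζ e lam
  have hlin := pv_lin_eq N (∑ c, π c * e c - (∑ c, π c * a c) * (∑ c, π c * ζ c)) P hP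
  -- corner-wise: Ψ_λ(c) = T_c − p_c(λ − Δ_c)²
  have hc : ∑ c, π c * (2 * lam * (m c - p c * a c) - lam ^ 2 * p c + 2 * (e c - a c * ζ c))
      = ∑ c, π c * ((m c - p c * a c) ^ 2 / p c + 2 * (e c - a c * ζ c))
        - ∑ c, π c * (p c * (lam - (m c - p c * a c) / p c) ^ 2) := by
    rw [← Finset.sum_sub_distrib]
    refine Finset.sum_congr rfl (fun c _ => ?_)
    have := pv_corner_reopt lam (m c - p c * a c) (e c - a c * ζ c) (p c) (hp c)
    rw [this]; ring
  have hN : N = ∑ c, π c * m c - P * (∑ c, π c * a c) := rfl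
  have hl : lam = N / P := rfl
  rw [hl] at hc hmix ⊢
  rw [hN] at hlin hmix hc ⊢
  linarith [hmix, hlin, hc]

/-! ### The single-seed chord defect in closed form -/

/-- **Chord identity for the per-vertex functional (one seed).**  With the mixture statistics of `pv_mixture_identity`
(`N(z) = (1−z)N⁰ + zN¹ + z(1−z)σd`, `p(z) = (1−z)p⁰ + zp¹`, `σ = p¹ − p⁰`, `G(z) = (1−z)G⁰ + zG¹ − z(1−z)dm`) and `T = N²/p + 2G`:
`(1−z)T⁰ + zT¹ − T(z) = z(1−z)·[p⁰p¹(N¹/p¹ − N⁰/p⁰)²/p + z(1−z)σ²d²/p − 2dσN/p + 2dm]`.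
(Percolation reading: the bracket is `p⁰p¹(Δ¹_v−Δ⁰_v)²/p_v + z(1−z)σ_{v;y}²d_y²/p_v − 2d_yσ_{v;y}(Δ_v − b_{v,y})`; its non-negativity — the CHORD
criterion, weaker than `Δ_v ≤ b_{v,y}` — is what the one-seed case of `pv_layer_step` needs; memo gen 43 §2, §4.) [this work] -/
theorem pv_chord_identity (N0 N1 G0 G1 p0 p1 d m z : ℝ) (hp0 : 0 < p0) (hp1 : 0 < p1)
    (hp : 0 < (1 - z) * p0 + z * p1) :
    (1 - z) * (N0 ^ 2 / p0 + 2 * G0) + z * (N1 ^ 2 / p1 + 2 * G1)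
        - (((1 - z) * N0 + z * N1 + z * (1 - z) * (p1 - p0) * d) ^ 2 / ((1 - z) * p0 + z * p1)
            + 2 * ((1 - z) * G0 + z * G1 - z * (1 - z) * d * m)) =
      z * (1 - z) * (p0 * p1 * (N1 / p1 - N0 / p0) ^ 2 / ((1 - z) * p0 + z * p1)
        + z * (1 - z) * (p1 - p0) ^ 2 * d ^ 2 / ((1 - z) * p0 + z * p1)
        - 2 * d * (p1 - p0) * ((1 - z) * N0 + z * N1 + z * (1 - z) * (p1 - p0) * d) / ((1 - z) * p0 + z * p1)
        + 2 * d * m) := by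
  have hp0' : p0 ≠ 0 := ne_of_gt hp0
  have hp1' : p1 ≠ 0 := ne_of_gt hp1
  have hp' : (1 - z) * p0 + z * p1 ≠ 0 := ne_of_gt hp
  field_simp
  ring

/-- **Chord step for `T_v` (one seed, chord criterion).**  If `T_v ≤ 0` at both endpoint instances, `z ∈ [0,1]`, and the chord bracket of
`pv_chord_identity` is non-negative, then `T_v(z) ≤ 0`.  This weakens the hypothesis `λδ ≤ m` of `pv_Tv_step` (gen 42) to the chord
criterion. [this work] -/
theorem pv_chord_step (N0 N1 G0 G1 p0 p1 d m z : ℝ) (hp0 : 0 < p0) (hp1 : 0 < p1) (hz0 : 0 ≤ z) (hz1 : z ≤ 1)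
    (hT0 : N0 ^ 2 / p0 + 2 * G0 ≤ 0) (hT1 : N1 ^ 2 / p1 + 2 * G1 ≤ 0)
    (hchord : 0 ≤ p0 * p1 * (N1 / p1 - N0 / p0) ^ 2 / ((1 - z) * p0 + z * p1)
        + z * (1 - z) * (p1 - p0) ^ 2 * d ^ 2 / ((1 - z) * p0 + z * p1)
        - 2 * d * (p1 - p0) * ((1 - z) * N0 + z * N1 + z * (1 - z) * (p1 - p0) * d) / ((1 - z) * p0 + z * p1)
        + 2 * d * m) :
    ((1 - z) * N0 + z * N1 + z * (1 - z) * (p1 - p0) * d) ^ 2 / ((1 - z) * p0 + z * p1)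
        + 2 * ((1 - z) * G0 + z * G1 - z * (1 - z) * d * m) ≤ 0 := by
  have hpz : 0 < (1 - z) * p0 + z * p1 := by
    rcases eq_or_lt_of_le hz1 with h | h
    · subst h; simpa using hp1
    · have : 0 < (1 - z) * p0 := mul_pos (by linarith) hp0
      have : 0 ≤ z * p1 := mul_nonneg hz0 hp1.le
      linarith
  have hid := pv_chord_identity N0 N1 G0 G1 p0 p1 d m z hp0 hp1 hpz
  have hz' : 0 ≤ 1 - z := by linarith
  have hA : (1 - z) * (N0 ^ 2 / p0 + 2 * G0) ≤ 0 := mul_nonpos_of_nonneg_of_nonpos hz' hT0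
  have hB : z * (N1 ^ 2 / p1 + 2 * G1) ≤ 0 := mul_nonpos_of_nonneg_of_nonpos hz0 hT1
  have hC : 0 ≤ z * (1 - z) * (p0 * p1 * (N1 / p1 - N0 / p0) ^ 2 / ((1 - z) * p0 + z * p1)
        + z * (1 - z) * (p1 - p0) ^ 2 * d ^ 2 / ((1 - z) * p0 + z * p1)
        - 2 * d * (p1 - p0) * ((1 - z) * N0 + z * N1 + z * (1 - z) * (p1 - p0) * d) / ((1 - z) * p0 + z * p1)
        + 2 * d * m) := mul_nonneg (mul_nonneg hz0 hz') hchord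
  linarith

/-! ### A selection-free case: the dominant seed -/

/-- **Dominant-seed criterion for the chord bracket.**  In the one-seed situation of `pv_chord_identity` write the glued-endpoint
covariance through the cut-endpoint one: `N¹ = N⁰ − u + m − σd` with `σ = p¹ − p⁰`, `m = E₀[ℓ(C_v); v∉K, y∈C_v]` and
`u := p⁰(d − E₀[D | v∈K]) + σ(E₀A − E₀[A | v∉K, y∈C_v]) ≥ 0` (`D = 1[y∉K]ℓ(C_y)`; the two brackets are non-negative by the
Harris / van den Berg–Häggström–Kahn rows used in gens 40–41 — here `u ≥ 0` is simply a hypothesis).  If the seed `y` is DOMINANT for `v`,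
`σ ≥ p⁰` (i.e. `2p⁰ ≤ p¹`: `v` is at least as likely to hang on `y` unglued as to be glued without `y`), then the chord bracket of
`pv_chord_identity` is non-negative for every `z ≥ 0` with `d ≥ 0`: after clearing the denominator it equals
`p⁰(u + σ(x+d))²/p¹ + z(1+z)σ²d² + 2zdσu − 2p⁰dσx` with `x = N⁰/p⁰ − m/σ` (`= Δ⁰_v − b_{v,y}`), and for `x > 0` AM–GM gives
`(u+σ(x+d))² ≥ 4σ²xd ≥ 2p¹σxd`.  (Memo gen 43 §5: chord-bad seeds are always weakly coupled.) [this work] -/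
theorem pv_chord_bracket_of_dominant (N0 p0 p1 d m z u : ℝ) (hp0 : 0 < p0) (hdom : 2 * p0 ≤ p1)
    (hz0 : 0 ≤ z) (hd : 0 ≤ d) (hu : 0 ≤ u) :
    0 ≤ p0 * p1 * ((N0 - u + m - (p1 - p0) * d) / p1 - N0 / p0) ^ 2 / ((1 - z) * p0 + z * p1)
        + z * (1 - z) * (p1 - p0) ^ 2 * d ^ 2 / ((1 - z) * p0 + z * p1)
        - 2 * d * (p1 - p0) * ((1 - z) * N0 + z * (N0 - u + m - (p1 - p0) * d) + z * (1 - z) * (p1 - p0) * d)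
            / ((1 - z) * p0 + z * p1)
        + 2 * d * m := by
  have hσpos : 0 < p1 - p0 := by linarith
  have hp1 : 0 < p1 := by linarith
  have hp : 0 < (1 - z) * p0 + z * p1 := by
    have : (1 - z) * p0 + z * p1 = p0 + z * (p1 - p0) := by ring
    rw [this]; positivity
  have hp0' : p0 ≠ 0 := ne_of_gt hp0
  have hp1' : p1 ≠ 0 := ne_of_gt hp1
  have hσ' : p1 - p0 ≠ 0 := ne_of_gt hσpos
  -- x = Δ⁰ − b, where b = m/σ
  obtain ⟨x, hm⟩ : ∃ x : ℝ, m = (p1 - p0) * (N0 / p0 - x) :=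
    ⟨N0 / p0 - m / (p1 - p0), by field_simp; ring⟩
  generalize hD : (1 - z) * p0 + z * p1 = D at hp ⊢
  have hD' : D ≠ 0 := ne_of_gt hp
  have key : (p0 * p1 * ((N0 - u + m - (p1 - p0) * d) / p1 - N0 / p0) ^ 2 / D
        + z * (1 - z) * (p1 - p0) ^ 2 * d ^ 2 / D
        - 2 * d * (p1 - p0) * ((1 - z) * N0 + z * (N0 - u + m - (p1 - p0) * d) + z * (1 - z) * (p1 - p0) * d) / D
        + 2 * d * m) * D
      = p0 * (u + (p1 - p0) * (x + d)) ^ 2 / p1 + z * (1 + z) * (p1 - p0) ^ 2 * d ^ 2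
        + 2 * z * d * (p1 - p0) * u - 2 * p0 * d * (p1 - p0) * x := by
    rw [hm]
    field_simp
    subst hD
    ring
  have rhs_nonneg : 0 ≤ p0 * (u + (p1 - p0) * (x + d)) ^ 2 / p1 + z * (1 + z) * (p1 - p0) ^ 2 * d ^ 2
      + 2 * z * d * (p1 - p0) * u - 2 * p0 * d * (p1 - p0) * x := by
    have t2 : 0 ≤ z * (1 + z) * (p1 - p0) ^ 2 * d ^ 2 := by positivity
    have t3 : 0 ≤ 2 * z * d * (p1 - p0) * u := by positivity
    have t1 : 0 ≤ p0 * (u + (p1 - p0) * (x + d)) ^ 2 / p1 := by positivity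
    rcases le_or_gt x 0 with hxle | hxgt
    · have t4 : 2 * p0 * d * (p1 - p0) * x ≤ 0 := by
        have : 0 ≤ 2 * p0 * d * (p1 - p0) := by positivity
        exact mul_nonpos_of_nonneg_of_nonpos this hxle
      linarith
    · -- x > 0: (u + σ(x+d))² ≥ σ²(x+d)² ≥ 4σ²xd ≥ 2 p1 σ x d  since 2σ ≥ p1
      have ha : 0 ≤ (p1 - p0) * (x + d) := by positivity
      have hsq : (p1 - p0) ^ 2 * (x + d) ^ 2 ≤ (u + (p1 - p0) * (x + d)) ^ 2 := by
        have hdiff : (u + (p1 - p0) * (x + d)) ^ 2 - (p1 - p0) ^ 2 * (x + d) ^ 2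
            = u * (u + 2 * ((p1 - p0) * (x + d))) := by ring
        have : 0 ≤ u * (u + 2 * ((p1 - p0) * (x + d))) := by positivity
        linarith
      have hamgm : 4 * x * d ≤ (x + d) ^ 2 := by nlinarith [sq_nonneg (x - d)]
      have h2σ : p1 ≤ 2 * (p1 - p0) := by linarith
      have hq : 0 ≤ 2 * d * (p1 - p0) * x := by positivity
      have step : 2 * p1 * d * (p1 - p0) * x ≤ (u + (p1 - p0) * (x + d)) ^ 2 := by
        have s1 : p1 * (2 * d * (p1 - p0) * x) ≤ (2 * (p1 - p0)) * (2 * d * (p1 - p0) * x) :=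
          mul_le_mul_of_nonneg_right h2σ hq
        have s2 : (p1 - p0) ^ 2 * (4 * x * d) ≤ (p1 - p0) ^ 2 * (x + d) ^ 2 :=
          mul_le_mul_of_nonneg_left hamgm (by positivity)
        have e1 : 2 * p1 * d * (p1 - p0) * x = p1 * (2 * d * (p1 - p0) * x) := by ring
        have e2 : (2 * (p1 - p0)) * (2 * d * (p1 - p0) * x) = (p1 - p0) ^ 2 * (4 * x * d) := by ring
        linarith
      have t5 : 2 * p0 * d * (p1 - p0) * x ≤ p0 * (u + (p1 - p0) * (x + d)) ^ 2 / p1 := by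
        rw [le_div_iff₀ hp1]
        have s3 := mul_le_mul_of_nonneg_left step hp0.le
        have e3 : 2 * p0 * d * (p1 - p0) * x * p1 = p0 * (2 * p1 * d * (p1 - p0) * x) := by ring
        linarith
      linarith
  have hprod : 0 ≤ (p0 * p1 * ((N0 - u + m - (p1 - p0) * d) / p1 - N0 / p0) ^ 2 / D
        + z * (1 - z) * (p1 - p0) ^ 2 * d ^ 2 / D
        - 2 * d * (p1 - p0) * ((1 - z) * N0 + z * (N0 - u + m - (p1 - p0) * d) + z * (1 - z) * (p1 - p0) * d) / D
        + 2 * d * m) * D := by rw [key]; exact rhs_nonneg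
  exact (mul_nonneg_iff_of_pos_right hp).mp hprod

/-- **Selection-free per-vertex step at a dominant seed.**  If `T_v ≤ 0` at both endpoint instances of the apex edge of a seed `y`
that is dominant for `v` (`2p⁰ ≤ p¹`), with `N¹ = N⁰ − u + m − (p¹−p⁰)d`, `u ≥ 0`, `d ≥ 0`, then `T_v(z) ≤ 0` for every `z ∈ [0,1]` —
no selection statement is needed for such `(v, y)`. [this work] -/
theorem pv_Tv_step_of_dominant (N0 G0 G1 p0 p1 d m z u : ℝ) (hp0 : 0 < p0) (hdom : 2 * p0 ≤ p1)
    (hz0 : 0 ≤ z) (hz1 : z ≤ 1) (hd : 0 ≤ d) (hu : 0 ≤ u)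
    (hT0 : N0 ^ 2 / p0 + 2 * G0 ≤ 0) (hT1 : (N0 - u + m - (p1 - p0) * d) ^ 2 / p1 + 2 * G1 ≤ 0) :
    ((1 - z) * N0 + z * (N0 - u + m - (p1 - p0) * d) + z * (1 - z) * (p1 - p0) * d) ^ 2 / ((1 - z) * p0 + z * p1)
        + 2 * ((1 - z) * G0 + z * G1 - z * (1 - z) * d * m) ≤ 0 := by
  have hp1 : 0 < p1 := by linarith
  exact pv_chord_step N0 (N0 - u + m - (p1 - p0) * d) G0 G1 p0 p1 d m z hp0 hp1 hz0 hz1 hT0 hT1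
    (pv_chord_bracket_of_dominant N0 p0 p1 d m z u hp0 hdom hz0 hd hu)

/-! ### The chord criterion is monotone in the weight -/

/-- **Weight-monotonicity of the chord bracket.**  With `N¹ = N⁰ − u + m − σd` (`σ = p¹ − p⁰`; `u` as in `pv_chord_bracket_of_dominant`) the chord
bracket of `pv_chord_identity` times `p(z) = (1−z)p⁰ + zp¹` equals `p⁰·[bracket at z = 0] + z(1+z)σ²d² + 2zdσu`.  (Memo gen 43 §5: hence the chord
criterion for `(v, y)` is a property of the cut instance `w∖e` alone.) [this work] -/
theorem pv_chord_bracket_monotone (N0 p0 p1 d m z u : ℝ) (hp0 : 0 < p0) (hp1 : 0 < p1)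
    (hp : 0 < (1 - z) * p0 + z * p1) :
    (p0 * p1 * ((N0 - u + m - (p1 - p0) * d) / p1 - N0 / p0) ^ 2 / ((1 - z) * p0 + z * p1)
        + z * (1 - z) * (p1 - p0) ^ 2 * d ^ 2 / ((1 - z) * p0 + z * p1)
        - 2 * d * (p1 - p0) * ((1 - z) * N0 + z * (N0 - u + m - (p1 - p0) * d) + z * (1 - z) * (p1 - p0) * d)
            / ((1 - z) * p0 + z * p1)
        + 2 * d * m) * ((1 - z) * p0 + z * p1)
      = p0 * (p1 * ((N0 - u + m - (p1 - p0) * d) / p1 - N0 / p0) ^ 2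
              - 2 * d * (p1 - p0) * N0 / p0 + 2 * d * m)
        + z * (1 + z) * (p1 - p0) ^ 2 * d ^ 2 + 2 * z * d * (p1 - p0) * u := by
  have hp0' : p0 ≠ 0 := ne_of_gt hp0
  have hp1' : p1 ≠ 0 := ne_of_gt hp1
  generalize hD : (1 - z) * p0 + z * p1 = D at hp ⊢
  have hD' : D ≠ 0 := ne_of_gt hp
  field_simp
  subst hD
  ring

/-- **The criterion at weight 0 suffices.**  If `u ≥ 0`, `d ≥ 0`, `z ≥ 0` and the weight-0 bracket
`p¹(Δ¹−Δ⁰)² − 2dσΔ⁰ + 2dm` (`= p¹(Δ¹−Δ⁰)² − 2dσ(Δ⁰ − b_{v,y})`, (CH0) of the memo) is non-negative, then the chord bracket is non-negative at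
weight `z`, so `pv_chord_step` applies at every weight. [this work] -/
theorem pv_chord_bracket_of_zero (N0 p0 p1 d m z u : ℝ) (hp0 : 0 < p0) (hp1 : p0 < p1)
    (hz0 : 0 ≤ z) (hd : 0 ≤ d) (hu : 0 ≤ u)
    (h0 : 0 ≤ p1 * ((N0 - u + m - (p1 - p0) * d) / p1 - N0 / p0) ^ 2 - 2 * d * (p1 - p0) * N0 / p0 + 2 * d * m) :
    0 ≤ p0 * p1 * ((N0 - u + m - (p1 - p0) * d) / p1 - N0 / p0) ^ 2 / ((1 - z) * p0 + z * p1)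
        + z * (1 - z) * (p1 - p0) ^ 2 * d ^ 2 / ((1 - z) * p0 + z * p1)
        - 2 * d * (p1 - p0) * ((1 - z) * N0 + z * (N0 - u + m - (p1 - p0) * d) + z * (1 - z) * (p1 - p0) * d)
            / ((1 - z) * p0 + z * p1)
        + 2 * d * m := by
  have hp1pos : 0 < p1 := by linarith
  have hσ : 0 ≤ p1 - p0 := by linarith
  have hp : 0 < (1 - z) * p0 + z * p1 := by
    have : (1 - z) * p0 + z * p1 = p0 + z * (p1 - p0) := by ring
    rw [this]; positivity
  have hid := pv_chord_bracket_monotone N0 p0 p1 d m z u hp0 hp1pos hp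
  have hrhs : 0 ≤ p0 * (p1 * ((N0 - u + m - (p1 - p0) * d) / p1 - N0 / p0) ^ 2
              - 2 * d * (p1 - p0) * N0 / p0 + 2 * d * m)
        + z * (1 + z) * (p1 - p0) ^ 2 * d ^ 2 + 2 * z * d * (p1 - p0) * u := by positivity
  rw [← hid] at hrhs
  exact (mul_nonneg_iff_of_pos_right hp).mp hrhs

end APL

end Summit.CriticalPhenomena.PercolationContinuityZ3.Theorems

end
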